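/-
Copyright (c) 2026 the pub-hodgecm-mathlib formalisation cell (harness21).  Prover seat hodgecm-mathlib-K2E3-p05 (g3), Track B «K2-LIT», engine E3, unit U4 «Keys»;
PLACE-FREE LAYER (`hd ↦ hϖ`) of ★ II-1 p855550 `K2E3PSIwahoriBasis` (g0); 2026-09-04.  KERNEL module: THEOREMS ONLY (no definition, no named fact, no `sorry`, no instance, no notation).
-/
import Summits.HodgeConjecture.HodgeConjecture.Theorems.K2E3PSLevelsPF             -- ★-filed (this seat): PS-LEVELS-PF (`finrank_…_I ∕ _K1`, cells) over `hϖ`; brings ★ PS-LEVELS (`finrank_…_K0`, hd-free), ★ P1∕P2a PLACE-FREE, FILE C, ★ BruhatIwahoriThree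
import HarnessLib

/-!
# K2 ∕ E3 «EllipticInputs», unit U4 «Keys» — Road II′ (TAME RAMIFIED places), PLACE-FREE LAYER II-1-PF «IWAHORI BASIS»: the Iwahori pair `(f₁, f_w)`, `i_G(χ)^I = ℂf₁ ⊕ ℂf_w`,
# the spherical lines `ℂ(f₁ + f_w)`, `ℂ(f₁ + μ⁻¹f_w)` for an UNRAMIFIED `χ` at EVERY non-split `v` (unramified OR ramified), over the uniformiser token `hϖ` alone
# [Casselman1980 §3; Borel1976 §4; BruhatTits1972 (4.4.3)–(4.4.4)]

Cell hodgecm-mathlib (D-0151), FLOOR 0, Track B «K2-LIT», engine E3, crux item H413 = stmt-HodgeConjecture-24833 (route `HCCMUnconditional`, no route verbs); target BY NAME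
`…K2E3EllipticInputs.U4Keys.sig_K2E3KeysThmTwoContracting` (U4-f), residue (R1) «ramified places» of MEMO v4 (Road II′).  Author K2E3-p05 (g3).  `--supports stmt-HodgeConjecture-24833
--as helper`; THEOREMS ONLY.  This is ★ II-1 `K2E3PSIwahoriBasis` with the unramified datum `hd` replaced by `hϖ : |ϖ|_w = exp(−1)` (★ II-1 reads `hd` only through `hd.σσ`,
`hd.vσ`, `hd.vϖ`; the first two are the place-free theorems ★ `galAdicCompletionMap_galAdicCompletionMap_of_smul_eq`, ★ `valued_galAdicCompletionMap`), proofs VERBATIM, cross-file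
calls re-pointed to ★ P1 `F0P3cStCharTSStLevelsPF` and ★ PS-LEVELS-PF.  The seven statements: `exists_iwahoriPair`, `eq_of_mem_fixedPoints_I`, `eq_smul_of_mem_fixedPoints_K0`,
`add_mem_fixedPoints_K0`, `eq_smul_of_mem_fixedPoints_K1`, `add_smul_mem_fixedPoints_K1`, `exists_borel_mul_weyl_mem_K1` — see ★ II-1 for the mathematics (`G_v = B·I ⊔ B·w̃·I`, MACKEY).
HONEST LABEL: HC_CM is proved only modulo the 7 printed citations (2 remaining named inputs: hLiu418 = stmt-HodgeConjecture-24832, h413 = stmt-HodgeConjecture-24833)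
until rung 0 closes; count-neutral (place-free twin; ★ II-1 is NOT edited; no printed citation is discharged).

## References
* [Casselman1980] W. Casselman, Compositio Math. 40 (1980), §3.  * [Borel1976] A. Borel, Invent. Math. 35 (1976), §3–§4.  * [BruhatTits1972] Publ. Math. IHÉS 41 (1972), (4.4.3)–(4.4.4).
* [Rogawski1990] J. D. Rogawski, Ann. of Math. Stud. 123 (1990), §4.5 p. 45, §12.1 p. 171, §12.2 p. 173.  * [Tits1979] J. Tits, PSPM 33.1 (1979), §2.4, §3.3.2.
-/

set_option autoImplicit false
-- the mandated namespace has the single-problem summit's repeated segment (`HodgeConjecture.HodgeConjecture`)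
set_option linter.dupNamespace false

noncomputable section

open NumberField IsDedekindDomain MeasureTheory
open scoped Matrix MatrixGroups NNReal WithZero
open Literature.NumberTheory.Automorphic Literature.NumberTheory.Automorphic.UnitaryGroup
open Literature.NumberTheory.Rogawski1990 Literature.NumberTheory.GaloisRepresentations

namespace Summit.HodgeConjecture.HodgeConjecture.Cruxes.H413.K2E3PSIwahoriBasisPF

open Summit.HodgeConjecture.HodgeConjecture.Cruxes.H413
open Summit.HodgeConjecture.HodgeConjecture.Cruxes.H413.F0P3cStCharTSStLevelsTransport
open Summit.HodgeConjecture.HodgeConjecture.Cruxes.H413.F0P3cStCharTSPSLevelsCells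
open Summit.HodgeConjecture.HodgeConjecture.Cruxes.H413.F0P3cStCharTSPSLevels

variable (L : Type) [Field L] [NumberField L] [IsCMField L] (v : HeightOneSpectrum (𝓞 ↥(maximalRealSubfield L)))
  (w : PlacesOver L v) (hw : IsCMField.complexConj L • w.1 = w.1)
  (eA : Gqs L v ≃ₜ* ↥(unitaryGroupOfForm (galAdicCompletionMap (L := L) (IsCMField.complexConj L) hw) ((StdForm.antidiagonal 3).over (w.1.adicCompletion L))))
  (heA : ∀ g : Gqs L v,
    ((eA g : ↥(unitaryGroupOfForm (galAdicCompletionMap (L := L) (IsCMField.complexConj L) hw) ((StdForm.antidiagonal 3).over (w.1.adicCompletion L)))) : GL (Fin 3) (w.1.adicCompletion L)) =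
      ((localNonsplitEquiv (IsCMField.complexConj L) (qsForm L) (IsCMField.complexConj_ne_one L) w hw g :
        ↥(unitaryGroupOfForm (galAdicCompletionMap (L := L) (IsCMField.complexConj L) hw) (placeForm (qsForm L) w.1))) : GL (Fin 3) (w.1.adicCompletion L)))

/-! ## §1 The Iwahori pair `(f₁, f_w)` -/

include heA in
set_option maxHeartbeats 3200000 in
set_option synthInstance.maxHeartbeats 400000 in
-- instance-path unification between `Gqs L v` and the literal carrier of ★ `cmPrincipalSeries` (class of ★ PS-LEVELS)
/-- **The Iwahori pair.**  For an UNRAMIFIED `χ` there are `I`-fixed vectors `f₁, f_w ∈ i_G(χ)` with `f₁(1) = 1`, `f₁(w̃) = 0`, `f_w(1) = 0`, `f_w(w̃) = 1`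
(`w̃ = eA⁻¹ w`): ★ MACKEY (M3) over the Bruhat–Iwahori decomposition `G_v = B·I ⊔ B·w̃·I` (★ `F0P3cStCharTSStLevelsPF.cover_borel_I` ∕ `F0P3cStCharTSStLevelsPF.disj_borel_I`), the inducing line being trivial on
`B ∩ I` and `B ∩ w̃Iw̃⁻¹` (both in `B ∩ K_v`; ★ `inducingLine_eq_one_of_mem_integralLevel`). [cite: Casselman1980, §3] [cite: Borel1976, §4] [cite: BruhatTits1972, (4.4.4)] -/
theorem exists_iwahoriPair {ϖ : w.1.adicCompletion L}
    (hϖ : Valued.v ϖ = WithZero.exp (-1 : ℤ))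
    (g₁ : GL (Fin 3) (w.1.adicCompletion L)) (hg₁ : (g₁ : Matrix (Fin 3) (Fin 3) (w.1.adicCompletion L)) = Matrix.diagonal ![(1 : w.1.adicCompletion L), 1, ϖ])
    (K0 K1 I : Subgroup (Gqs L v))
    (hK0 : K0 = ((glInt 3 (w.1.adicCompletion L)).subgroupOf
      (unitaryGroupOfForm (galAdicCompletionMap (L := L) (IsCMField.complexConj L) hw) ((StdForm.antidiagonal 3).over (w.1.adicCompletion L)))).comap
        eA.toMulEquiv.toMonoidHom)
    (hK1 : K1 = (((glInt 3 (w.1.adicCompletion L)).map (MulAut.conj g₁).toMonoidHom).subgroupOf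
      (unitaryGroupOfForm (galAdicCompletionMap (L := L) (IsCMField.complexConj L) hw) ((StdForm.antidiagonal 3).over (w.1.adicCompletion L)))).comap
        eA.toMulEquiv.toMonoidHom)
    (hI : I = K0 ⊓ K1)
    (χ : ↥(torusU (conjLocal L (IsCMField.complexConj L) v) (cmLocalForm L 3 v)) →* ℂˣ)
    (hU : ∀ t : ↥(torusU (conjLocal L (IsCMField.complexConj L) v) (cmLocalForm L 3 v)),
      (t : ↥(unitaryGroupOfForm (conjLocal L (IsCMField.complexConj L) v) (cmLocalForm L 3 v))) ∈ cmLocalIntegralLevel L 3 (qsForm L) v → χ t = 1) :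
    haveI := locallyCompactSpace_cmBorelU L 3 v
    ∃ f₁ f_w : Representation.SmoothInd (cmBorelTriple L 3 v).P
        (Representation.twist (((Representation.trivial ℂ ↥(torusU (conjLocal L (IsCMField.complexConj L) v) (cmLocalForm L 3 v)) ℂ).twist χ).comp
          (cmBorelTriple L 3 v).proj) (rootDeltaChar (cmBorelTriple L 3 v).P)),
      f₁ ∈ (cmPrincipalSeries L 3 v χ).fixedPoints I ∧ f_w ∈ (cmPrincipalSeries L 3 v χ).fixedPoints I ∧
      f₁.toFun 1 = 1 ∧
      f₁.toFun (eA.symm (weylLongU (galAdicCompletionMap (L := L) (IsCMField.complexConj L) hw) (rfl : (StdForm.antidiagonal 3).over (w.1.adicCompletion L) = _))) = 0 ∧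
      f_w.toFun 1 = 0 ∧
      f_w.toFun (eA.symm (weylLongU (galAdicCompletionMap (L := L) (IsCMField.complexConj L) hw) (rfl : (StdForm.antidiagonal 3).over (w.1.adicCompletion L) = _))) = 1 := by
  haveI := locallyCompactSpace_cmBorelU L 3 v
  have hIo' := (isOpen_isCompact_levels L v w hw eA g₁ K0 K1 I hK0 hK1 hI).2.2.1
  have hIo : @IsOpen ↥(unitaryGroupOfForm (conjLocal L (IsCMField.complexConj L) v) (cmLocalForm L 3 v)) inferInstance (I : Set (Gqs L v)) := hIo'
  have hcov := F0P3cStCharTSStLevelsPF.cover_borel_I L v w hw eA heA hϖ g₁ hg₁ K0 K1 I hK0 hK1 hI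
  have hdis := F0P3cStCharTSStLevelsPF.disj_borel_I L v w hw eA heA hϖ g₁ hg₁ K0 K1 I hK0 hK1 hI
  -- the inducing line is trivial on `B ∩ gᵢ I gᵢ⁻¹`, `i = 0, 1` (the filter condition of ★ PS-LEVELS under `U`)
  have hw0 : (![(1 : ↥(unitaryGroupOfForm (conjLocal L (IsCMField.complexConj L) v) (cmLocalForm L 3 v))), eA.symm (weylLongU (galAdicCompletionMap (L := L) (IsCMField.complexConj L) hw) (rfl : (StdForm.antidiagonal 3).over (w.1.adicCompletion L) = _))] 1) ∈ K0 :=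
    eA_symm_weylLongU_mem_K0 L v w hw eA K0 hK0
  have hIK0 : ∀ x : ↥(unitaryGroupOfForm (conjLocal L (IsCMField.complexConj L) v) (cmLocalForm L 3 v)), x ∈ I → x ∈ K0 := fun x hx => I_le_K0 L v K0 K1 I hI hx
  have htriv : ∀ (i : Fin 2) (h : ↥(cmBorelTriple L 3 v).P),
      (![(1 : ↥(unitaryGroupOfForm (conjLocal L (IsCMField.complexConj L) v) (cmLocalForm L 3 v))), eA.symm (weylLongU (galAdicCompletionMap (L := L) (IsCMField.complexConj L) hw) (rfl : (StdForm.antidiagonal 3).over (w.1.adicCompletion L) = _))] i)⁻¹ *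
          (h : ↥(unitaryGroupOfForm (conjLocal L (IsCMField.complexConj L) v) (cmLocalForm L 3 v))) *
          (![(1 : ↥(unitaryGroupOfForm (conjLocal L (IsCMField.complexConj L) v) (cmLocalForm L 3 v))), eA.symm (weylLongU (galAdicCompletionMap (L := L) (IsCMField.complexConj L) hw) (rfl : (StdForm.antidiagonal 3).over (w.1.adicCompletion L) = _))] i) ∈ I →
      (Representation.twist (((Representation.trivial ℂ ↥(torusU (conjLocal L (IsCMField.complexConj L) v) (cmLocalForm L 3 v)) ℂ).twist χ).comp
          (cmBorelTriple L 3 v).proj) (rootDeltaChar (cmBorelTriple L 3 v).P)) h = 1 := by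
    intro i h hmem
    have hhK0 : (h : ↥(unitaryGroupOfForm (conjLocal L (IsCMField.complexConj L) v) (cmLocalForm L 3 v))) ∈ K0 := by
      fin_cases i
      · have h' := hIK0 _ hmem
        simpa using h'
      · have h' : (![(1 : ↥(unitaryGroupOfForm (conjLocal L (IsCMField.complexConj L) v) (cmLocalForm L 3 v))), eA.symm (weylLongU (galAdicCompletionMap (L := L) (IsCMField.complexConj L) hw) (rfl : (StdForm.antidiagonal 3).over (w.1.adicCompletion L) = _))] (1 : Fin 2))⁻¹ *
            (h : ↥(unitaryGroupOfForm (conjLocal L (IsCMField.complexConj L) v) (cmLocalForm L 3 v))) * (![(1 : ↥(unitaryGroupOfForm (conjLocal L (IsCMField.complexConj L) v) (cmLocalForm L 3 v))), eA.symm (weylLongU (galAdicCompletionMap (L := L) (IsCMField.complexConj L) hw) (rfl : (StdForm.antidiagonal 3).over (w.1.adicCompletion L) = _))] (1 : Fin 2)) ∈ K0 := hIK0 _ hmem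
        have hprod := K0.mul_mem (K0.mul_mem hw0 h') (K0.inv_mem hw0)
        have heq : (h : ↥(unitaryGroupOfForm (conjLocal L (IsCMField.complexConj L) v) (cmLocalForm L 3 v))) =
            (![(1 : ↥(unitaryGroupOfForm (conjLocal L (IsCMField.complexConj L) v) (cmLocalForm L 3 v))), eA.symm (weylLongU (galAdicCompletionMap (L := L) (IsCMField.complexConj L) hw) (rfl : (StdForm.antidiagonal 3).over (w.1.adicCompletion L) = _))] (1 : Fin 2)) *
              ((![(1 : ↥(unitaryGroupOfForm (conjLocal L (IsCMField.complexConj L) v) (cmLocalForm L 3 v))), eA.symm (weylLongU (galAdicCompletionMap (L := L) (IsCMField.complexConj L) hw) (rfl : (StdForm.antidiagonal 3).over (w.1.adicCompletion L) = _))] (1 : Fin 2))⁻¹ *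
                (h : ↥(unitaryGroupOfForm (conjLocal L (IsCMField.complexConj L) v) (cmLocalForm L 3 v))) * (![(1 : ↥(unitaryGroupOfForm (conjLocal L (IsCMField.complexConj L) v) (cmLocalForm L 3 v))), eA.symm (weylLongU (galAdicCompletionMap (L := L) (IsCMField.complexConj L) hw) (rfl : (StdForm.antidiagonal 3).over (w.1.adicCompletion L) = _))] (1 : Fin 2))) *
              (![(1 : ↥(unitaryGroupOfForm (conjLocal L (IsCMField.complexConj L) v) (cmLocalForm L 3 v))), eA.symm (weylLongU (galAdicCompletionMap (L := L) (IsCMField.complexConj L) hw) (rfl : (StdForm.antidiagonal 3).over (w.1.adicCompletion L) = _))] (1 : Fin 2))⁻¹ := by group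
        rw [heq]
        exact hprod
    exact inducingLine_eq_one_of_mem_integralLevel L v χ hU h ((mem_K0_iff_mem_integralLevel L v w hw eA heA K0 hK0 _).1 hhK0)
  -- a value family `c` is admissible as soon as the line is trivial on the relevant subgroup
  have hfam : ∀ (c : Fin 2 → ℂ) (i : Fin 2), c i ∈ (Representation.twist (((Representation.trivial ℂ ↥(torusU (conjLocal L (IsCMField.complexConj L) v) (cmLocalForm L 3 v)) ℂ).twist χ).comp
          (cmBorelTriple L 3 v).proj) (rootDeltaChar (cmBorelTriple L 3 v).P)).fixedPoints
        ((I.map (MulAut.conj ((![(1 : ↥(unitaryGroupOfForm (conjLocal L (IsCMField.complexConj L) v) (cmLocalForm L 3 v))), eA.symm (weylLongU (galAdicCompletionMap (L := L) (IsCMField.complexConj L) hw) (rfl : (StdForm.antidiagonal 3).over (w.1.adicCompletion L) = _))] i))).toMonoidHom).subgroupOf (cmBorelTriple L 3 v).P) := by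
    intro c i
    rw [Representation.mem_fixedPoints]
    intro h hh
    rw [Representation.mem_subgroupOf_map_conj_iff] at hh
    rw [htriv i h hh, Module.End.one_apply]
  obtain ⟨f₁, hf₁, hv₁, -⟩ := Representation.exists_mem_fixedPoints_forall_toFun_eq
    (Representation.twist (((Representation.trivial ℂ ↥(torusU (conjLocal L (IsCMField.complexConj L) v) (cmLocalForm L 3 v)) ℂ).twist χ).comp
      (cmBorelTriple L 3 v).proj) (rootDeltaChar (cmBorelTriple L 3 v).P)) hIo hcov hdis ![(1 : ℂ), 0] (hfam _)
  obtain ⟨f_w, hf_w, hv_w, -⟩ := Representation.exists_mem_fixedPoints_forall_toFun_eq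
    (Representation.twist (((Representation.trivial ℂ ↥(torusU (conjLocal L (IsCMField.complexConj L) v) (cmLocalForm L 3 v)) ℂ).twist χ).comp
      (cmBorelTriple L 3 v).proj) (rootDeltaChar (cmBorelTriple L 3 v).P)) hIo hcov hdis ![(0 : ℂ), 1] (hfam _)
  refine ⟨f₁, f_w, hf₁, hf_w, ?_, ?_, ?_, ?_⟩
  · simpa using hv₁ 0
  · simpa using hv₁ 1
  · simpa using hv_w 0
  · simpa using hv_w 1

/-! ## §2 An `I`-fixed vector is determined by its values at `1` and `w̃` -/

include heA in
set_option maxHeartbeats 3200000 in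
set_option synthInstance.maxHeartbeats 400000 in
-- instance-path unification between `Gqs L v` and the literal carrier of ★ `cmPrincipalSeries` (class of ★ PS-LEVELS)
/-- **`f = f(1)·f₁ + f(w̃)·f_w` on `i_G(χ)^I`** (★ MACKEY (M2): an `I`-fixed vector is determined by its values at the Bruhat–Iwahori representatives `1, w̃`), for ANY
`I`-fixed `f₁, f_w` with the values of §1.  In particular `i_G(χ)^I = ℂ f₁ ⊕ ℂ f_w`. [cite: Casselman1980, §3] [cite: Borel1976, §4] -/
theorem eq_of_mem_fixedPoints_I {ϖ : w.1.adicCompletion L}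
    (hϖ : Valued.v ϖ = WithZero.exp (-1 : ℤ))
    (g₁ : GL (Fin 3) (w.1.adicCompletion L)) (hg₁ : (g₁ : Matrix (Fin 3) (Fin 3) (w.1.adicCompletion L)) = Matrix.diagonal ![(1 : w.1.adicCompletion L), 1, ϖ])
    (K0 K1 I : Subgroup (Gqs L v))
    (hK0 : K0 = ((glInt 3 (w.1.adicCompletion L)).subgroupOf
      (unitaryGroupOfForm (galAdicCompletionMap (L := L) (IsCMField.complexConj L) hw) ((StdForm.antidiagonal 3).over (w.1.adicCompletion L)))).comap
        eA.toMulEquiv.toMonoidHom)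
    (hK1 : K1 = (((glInt 3 (w.1.adicCompletion L)).map (MulAut.conj g₁).toMonoidHom).subgroupOf
      (unitaryGroupOfForm (galAdicCompletionMap (L := L) (IsCMField.complexConj L) hw) ((StdForm.antidiagonal 3).over (w.1.adicCompletion L)))).comap
        eA.toMulEquiv.toMonoidHom)
    (hI : I = K0 ⊓ K1)
    (χ : ↥(torusU (conjLocal L (IsCMField.complexConj L) v) (cmLocalForm L 3 v)) →* ℂˣ) :
    haveI := locallyCompactSpace_cmBorelU L 3 v
    ∀ (f₁ f_w f : Representation.SmoothInd (cmBorelTriple L 3 v).P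
        (Representation.twist (((Representation.trivial ℂ ↥(torusU (conjLocal L (IsCMField.complexConj L) v) (cmLocalForm L 3 v)) ℂ).twist χ).comp
          (cmBorelTriple L 3 v).proj) (rootDeltaChar (cmBorelTriple L 3 v).P))),
      f₁ ∈ (cmPrincipalSeries L 3 v χ).fixedPoints I → f_w ∈ (cmPrincipalSeries L 3 v χ).fixedPoints I → f ∈ (cmPrincipalSeries L 3 v χ).fixedPoints I →
      f₁.toFun 1 = 1 →
      f₁.toFun (eA.symm (weylLongU (galAdicCompletionMap (L := L) (IsCMField.complexConj L) hw) (rfl : (StdForm.antidiagonal 3).over (w.1.adicCompletion L) = _))) = 0 →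
      f_w.toFun 1 = 0 →
      f_w.toFun (eA.symm (weylLongU (galAdicCompletionMap (L := L) (IsCMField.complexConj L) hw) (rfl : (StdForm.antidiagonal 3).over (w.1.adicCompletion L) = _))) = 1 →
      f = f.toFun 1 • f₁ +
        f.toFun (eA.symm (weylLongU (galAdicCompletionMap (L := L) (IsCMField.complexConj L) hw) (rfl : (StdForm.antidiagonal 3).over (w.1.adicCompletion L) = _))) • f_w := by
  haveI := locallyCompactSpace_cmBorelU L 3 v
  intro f₁ f_w f hf₁ hf_w hf h11 h1w hw1 hww
  have hcov := F0P3cStCharTSStLevelsPF.cover_borel_I L v w hw eA heA hϖ g₁ hg₁ K0 K1 I hK0 hK1 hI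
  refine Representation.eq_of_forall_toFun_apply_eq
    (Representation.twist (((Representation.trivial ℂ ↥(torusU (conjLocal L (IsCMField.complexConj L) v) (cmLocalForm L 3 v)) ℂ).twist χ).comp
      (cmBorelTriple L 3 v).proj) (rootDeltaChar (cmBorelTriple L 3 v).P)) hcov hf (Submodule.add_mem _ (Submodule.smul_mem _ _ hf₁) (Submodule.smul_mem _ _ hf_w)) ?_
  intro i
  fin_cases i
  · simp [Representation.SmoothInd.toFun_add, Representation.SmoothInd.toFun_smul, h11, hw1]
  · simp [Representation.SmoothInd.toFun_add, Representation.SmoothInd.toFun_smul, h1w, hww]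

/-! ## §3 The `K₀`-spherical line `ℂ(f₁ + f_w)` -/

include heA in
set_option maxHeartbeats 3200000 in
set_option synthInstance.maxHeartbeats 400000 in
-- instance-path unification between `Gqs L v` and the literal carrier of ★ `cmPrincipalSeries` (class of ★ PS-LEVELS)
/-- **A `K₀`-fixed vector is `f(1)·(f₁ + f_w)`**: it is `I`-fixed (`I ≤ K₀`) with `f(w̃) = f(1·w̃) = (w̃·f)(1) = f(1)` (`w̃ ∈ K₀`, ★ `eA_symm_weylLongU_mem_K0`), and §2.
[cite: Casselman1980, §3] [cite: Rogawski1990, §4.5 p. 45] -/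
theorem eq_smul_of_mem_fixedPoints_K0 {ϖ : w.1.adicCompletion L}
    (hϖ : Valued.v ϖ = WithZero.exp (-1 : ℤ))
    (g₁ : GL (Fin 3) (w.1.adicCompletion L)) (hg₁ : (g₁ : Matrix (Fin 3) (Fin 3) (w.1.adicCompletion L)) = Matrix.diagonal ![(1 : w.1.adicCompletion L), 1, ϖ])
    (K0 K1 I : Subgroup (Gqs L v))
    (hK0 : K0 = ((glInt 3 (w.1.adicCompletion L)).subgroupOf
      (unitaryGroupOfForm (galAdicCompletionMap (L := L) (IsCMField.complexConj L) hw) ((StdForm.antidiagonal 3).over (w.1.adicCompletion L)))).comap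
        eA.toMulEquiv.toMonoidHom)
    (hK1 : K1 = (((glInt 3 (w.1.adicCompletion L)).map (MulAut.conj g₁).toMonoidHom).subgroupOf
      (unitaryGroupOfForm (galAdicCompletionMap (L := L) (IsCMField.complexConj L) hw) ((StdForm.antidiagonal 3).over (w.1.adicCompletion L)))).comap
        eA.toMulEquiv.toMonoidHom)
    (hI : I = K0 ⊓ K1)
    (χ : ↥(torusU (conjLocal L (IsCMField.complexConj L) v) (cmLocalForm L 3 v)) →* ℂˣ) :
    haveI := locallyCompactSpace_cmBorelU L 3 v
    ∀ (f₁ f_w f : Representation.SmoothInd (cmBorelTriple L 3 v).P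
        (Representation.twist (((Representation.trivial ℂ ↥(torusU (conjLocal L (IsCMField.complexConj L) v) (cmLocalForm L 3 v)) ℂ).twist χ).comp
          (cmBorelTriple L 3 v).proj) (rootDeltaChar (cmBorelTriple L 3 v).P))),
      f₁ ∈ (cmPrincipalSeries L 3 v χ).fixedPoints I → f_w ∈ (cmPrincipalSeries L 3 v χ).fixedPoints I → f ∈ (cmPrincipalSeries L 3 v χ).fixedPoints K0 →
      f₁.toFun 1 = 1 →
      f₁.toFun (eA.symm (weylLongU (galAdicCompletionMap (L := L) (IsCMField.complexConj L) hw) (rfl : (StdForm.antidiagonal 3).over (w.1.adicCompletion L) = _))) = 0 →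
      f_w.toFun 1 = 0 →
      f_w.toFun (eA.symm (weylLongU (galAdicCompletionMap (L := L) (IsCMField.complexConj L) hw) (rfl : (StdForm.antidiagonal 3).over (w.1.adicCompletion L) = _))) = 1 →
      f = f.toFun 1 • (f₁ + f_w) := by
  haveI := locallyCompactSpace_cmBorelU L 3 v
  intro f₁ f_w f hf₁ hf_w hf h11 h1w hw1 hww
  have hfI : f ∈ (cmPrincipalSeries L 3 v χ).fixedPoints I := by
    rw [Representation.mem_fixedPoints] at hf ⊢
    exact fun k hk => hf k (I_le_K0 L v K0 K1 I hI hk)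
  have hw0 : (![(1 : ↥(unitaryGroupOfForm (conjLocal L (IsCMField.complexConj L) v) (cmLocalForm L 3 v))), eA.symm (weylLongU (galAdicCompletionMap (L := L) (IsCMField.complexConj L) hw) (rfl : (StdForm.antidiagonal 3).over (w.1.adicCompletion L) = _))] 1) ∈ K0 := eA_symm_weylLongU_mem_K0 L v w hw eA K0 hK0
  have hval : f.toFun (eA.symm (weylLongU (galAdicCompletionMap (L := L) (IsCMField.complexConj L) hw) (rfl : (StdForm.antidiagonal 3).over (w.1.adicCompletion L) = _))) = f.toFun 1 := by
    have e : (cmPrincipalSeries L 3 v χ (![(1 : ↥(unitaryGroupOfForm (conjLocal L (IsCMField.complexConj L) v) (cmLocalForm L 3 v))), eA.symm (weylLongU (galAdicCompletionMap (L := L) (IsCMField.complexConj L) hw) (rfl : (StdForm.antidiagonal 3).over (w.1.adicCompletion L) = _))] 1) f).toFun 1 = f.toFun (1 * (![(1 : ↥(unitaryGroupOfForm (conjLocal L (IsCMField.complexConj L) v) (cmLocalForm L 3 v))), eA.symm (weylLongU (galAdicCompletionMap (L := L) (IsCMField.complexConj L) hw) (rfl : (StdForm.antidiagonal 3).over (w.1.adicCompletion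 L) = _))] 1)) := Representation.toFun_smoothIndRep_apply (![(1 : ↥(unitaryGroupOfForm (conjLocal L (IsCMField.complexConj L) v) (cmLocalForm L 3 v))), eA.symm (weylLongU (galAdicCompletionMap (L := L) (IsCMField.complexConj L) hw) (rfl : (StdForm.antidiagonal 3).over (w.1.adicCompletion L) = _))] 1) f 1
    rw [(Representation.mem_fixedPoints _ _ _).1 hf _ hw0, one_mul] at e
    simpa using e.symm
  have h := eq_of_mem_fixedPoints_I L v w hw eA heA hϖ g₁ hg₁ K0 K1 I hK0 hK1 hI χ f₁ f_w f hf₁ hf_w hfI h11 h1w hw1 hww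
  rw [hval, ← smul_add] at h
  exact h

include heA in
set_option maxHeartbeats 12000000 in
set_option synthInstance.maxHeartbeats 400000 in
-- instance-path unification between `Gqs L v` and the literal carrier of ★ `cmPrincipalSeries` (class of ★ PS-LEVELS)
/-- **`f₁ + f_w` IS `K₀`-fixed** (so `i_G(χ)^{K₀} = ℂ(f₁ + f_w)`): ★ `dim i_G(χ)^{K₀} = 1` for unramified `χ` gives a non-zero `K₀`-fixed `f₀`, which is `f₀(1)·(f₁ + f_w)` with
`f₀(1) ≠ 0` by the previous theorem — the spherical vector `φ_K = φ₁ + φ_w`. [cite: Casselman1980, §3] [cite: Rogawski1990, §4.5 p. 45] -/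
theorem add_mem_fixedPoints_K0 {ϖ : w.1.adicCompletion L}
    (hϖ : Valued.v ϖ = WithZero.exp (-1 : ℤ))
    (g₁ : GL (Fin 3) (w.1.adicCompletion L)) (hg₁ : (g₁ : Matrix (Fin 3) (Fin 3) (w.1.adicCompletion L)) = Matrix.diagonal ![(1 : w.1.adicCompletion L), 1, ϖ])
    (K0 K1 I : Subgroup (Gqs L v))
    (hK0 : K0 = ((glInt 3 (w.1.adicCompletion L)).subgroupOf
      (unitaryGroupOfForm (galAdicCompletionMap (L := L) (IsCMField.complexConj L) hw) ((StdForm.antidiagonal 3).over (w.1.adicCompletion L)))).comap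
        eA.toMulEquiv.toMonoidHom)
    (hK1 : K1 = (((glInt 3 (w.1.adicCompletion L)).map (MulAut.conj g₁).toMonoidHom).subgroupOf
      (unitaryGroupOfForm (galAdicCompletionMap (L := L) (IsCMField.complexConj L) hw) ((StdForm.antidiagonal 3).over (w.1.adicCompletion L)))).comap
        eA.toMulEquiv.toMonoidHom)
    (hI : I = K0 ⊓ K1)
    (χ : ↥(torusU (conjLocal L (IsCMField.complexConj L) v) (cmLocalForm L 3 v)) →* ℂˣ)
    (hU : ∀ t : ↥(torusU (conjLocal L (IsCMField.complexConj L) v) (cmLocalForm L 3 v)),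
      (t : ↥(unitaryGroupOfForm (conjLocal L (IsCMField.complexConj L) v) (cmLocalForm L 3 v))) ∈ cmLocalIntegralLevel L 3 (qsForm L) v → χ t = 1) :
    haveI := locallyCompactSpace_cmBorelU L 3 v
    ∀ (f₁ f_w : Representation.SmoothInd (cmBorelTriple L 3 v).P
        (Representation.twist (((Representation.trivial ℂ ↥(torusU (conjLocal L (IsCMField.complexConj L) v) (cmLocalForm L 3 v)) ℂ).twist χ).comp
          (cmBorelTriple L 3 v).proj) (rootDeltaChar (cmBorelTriple L 3 v).P))),
      f₁ ∈ (cmPrincipalSeries L 3 v χ).fixedPoints I → f_w ∈ (cmPrincipalSeries L 3 v χ).fixedPoints I →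
      f₁.toFun 1 = 1 →
      f₁.toFun (eA.symm (weylLongU (galAdicCompletionMap (L := L) (IsCMField.complexConj L) hw) (rfl : (StdForm.antidiagonal 3).over (w.1.adicCompletion L) = _))) = 0 →
      f_w.toFun 1 = 0 →
      f_w.toFun (eA.symm (weylLongU (galAdicCompletionMap (L := L) (IsCMField.complexConj L) hw) (rfl : (StdForm.antidiagonal 3).over (w.1.adicCompletion L) = _))) = 1 →
      f₁ + f_w ∈ (cmPrincipalSeries L 3 v χ).fixedPoints K0 := by
  intro f₁ f_w hf₁ hf_w h11 h1w hw1 hww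
  have hdim := finrank_fixedPoints_cmPrincipalSeries_K0 L v w hw eA heA K0 hK0 χ
  rw [if_pos hU] at hdim
  obtain ⟨x, hx, -⟩ := finrank_eq_one_iff'.1 hdim
  have hx1 := eq_smul_of_mem_fixedPoints_K0 L v w hw eA heA hϖ g₁ hg₁ K0 K1 I hK0 hK1 hI χ f₁ f_w x.1 hf₁ hf_w x.2 h11 h1w hw1 hww
  obtain ⟨c, hcdef⟩ : ∃ c : ℂ, c = x.1.toFun 1 := ⟨_, rfl⟩
  rw [← hcdef] at hx1
  have hc : c ≠ 0 := by
    intro h0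
    apply hx
    simp only [h0, zero_smul] at hx1
    exact Submodule.coe_eq_zero.1 hx1
  have heq := congrArg (fun y => c⁻¹ • y) hx1
  simp only [smul_smul, inv_mul_cancel₀ hc, one_smul] at heq
  rw [← heq]
  exact Submodule.smul_mem _ _ x.2

/-! ## §4 The `K₁`-spherical line `ℂ(f₁ + μ⁻¹ f_w)`, `μ = (χδ_B^{1∕2})(d)` for a Borel `d` with `d·w̃ ∈ K₁` -/

include heA in
set_option maxHeartbeats 3200000 in
set_option synthInstance.maxHeartbeats 400000 in
-- instance-path unification between `Gqs L v` and the literal carrier of ★ `cmPrincipalSeries` (class of ★ PS-LEVELS)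
/-- **A `K₁`-fixed vector is `f(1)·(f₁ + μ⁻¹ f_w)`**, `μ = χ(proj d)·δ_B^{1∕2}(d)` for ANY `d ∈ B_v` with `d·w̃ ∈ K₁` (such `d` exist: `d = diag(ϖ⁻¹, 1, σϖ)`, ★
`exists_mem_torusU_mul_weylLongU_mem_conj_glInt`; see `exists_borel_mul_weyl_mem_K1`): `f` is `I`-fixed (`I ≤ K₁`), and `f(1) = ((d w̃)·f)(1) = f(d w̃) = μ·f(w̃)`.
[cite: Casselman1980, §3] [cite: BruhatTits1972, (4.4.3)] -/
theorem eq_smul_of_mem_fixedPoints_K1 {ϖ : w.1.adicCompletion L}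
    (hϖ : Valued.v ϖ = WithZero.exp (-1 : ℤ))
    (g₁ : GL (Fin 3) (w.1.adicCompletion L)) (hg₁ : (g₁ : Matrix (Fin 3) (Fin 3) (w.1.adicCompletion L)) = Matrix.diagonal ![(1 : w.1.adicCompletion L), 1, ϖ])
    (K0 K1 I : Subgroup (Gqs L v))
    (hK0 : K0 = ((glInt 3 (w.1.adicCompletion L)).subgroupOf
      (unitaryGroupOfForm (galAdicCompletionMap (L := L) (IsCMField.complexConj L) hw) ((StdForm.antidiagonal 3).over (w.1.adicCompletion L)))).comap
        eA.toMulEquiv.toMonoidHom)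
    (hK1 : K1 = (((glInt 3 (w.1.adicCompletion L)).map (MulAut.conj g₁).toMonoidHom).subgroupOf
      (unitaryGroupOfForm (galAdicCompletionMap (L := L) (IsCMField.complexConj L) hw) ((StdForm.antidiagonal 3).over (w.1.adicCompletion L)))).comap
        eA.toMulEquiv.toMonoidHom)
    (hI : I = K0 ⊓ K1)
    (χ : ↥(torusU (conjLocal L (IsCMField.complexConj L) v) (cmLocalForm L 3 v)) →* ℂˣ)
    (d : ↥(cmBorelTriple L 3 v).P) (hdK1 : (d : ↥(unitaryGroupOfForm (conjLocal L (IsCMField.complexConj L) v) (cmLocalForm L 3 v))) * (![(1 : ↥(unitaryGroupOfForm (conjLocal L (IsCMField.complexConj L) v) (cmLocalForm L 3 v))), eA.symm (weylLongU (galAdicCompletionMap (L := L) (IsCMField.complexConj L) hw) (rfl : (StdForm.antidiagonal 3).over (w.1.adicCompletion L) = _))] 1) ∈ K1) :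
    haveI := locallyCompactSpace_cmBorelU L 3 v
    ∀ (f₁ f_w f : Representation.SmoothInd (cmBorelTriple L 3 v).P
        (Representation.twist (((Representation.trivial ℂ ↥(torusU (conjLocal L (IsCMField.complexConj L) v) (cmLocalForm L 3 v)) ℂ).twist χ).comp
          (cmBorelTriple L 3 v).proj) (rootDeltaChar (cmBorelTriple L 3 v).P))),
      f₁ ∈ (cmPrincipalSeries L 3 v χ).fixedPoints I → f_w ∈ (cmPrincipalSeries L 3 v χ).fixedPoints I → f ∈ (cmPrincipalSeries L 3 v χ).fixedPoints K1 →
      f₁.toFun 1 = 1 →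
      f₁.toFun (eA.symm (weylLongU (galAdicCompletionMap (L := L) (IsCMField.complexConj L) hw) (rfl : (StdForm.antidiagonal 3).over (w.1.adicCompletion L) = _))) = 0 →
      f_w.toFun 1 = 0 →
      f_w.toFun (eA.symm (weylLongU (galAdicCompletionMap (L := L) (IsCMField.complexConj L) hw) (rfl : (StdForm.antidiagonal 3).over (w.1.adicCompletion L) = _))) = 1 →
      f = f.toFun 1 • (f₁ + (((χ ((cmBorelTriple L 3 v).proj d) : ℂˣ) : ℂ) * ((rootDeltaChar (cmBorelTriple L 3 v).P d : ℂˣ) : ℂ))⁻¹ • f_w) := by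
  haveI := locallyCompactSpace_cmBorelU L 3 v
  intro f₁ f_w f hf₁ hf_w hf h11 h1w hw1 hww
  have hfI : f ∈ (cmPrincipalSeries L 3 v χ).fixedPoints I := by
    rw [Representation.mem_fixedPoints] at hf ⊢
    exact fun k hk => hf k (I_le_K1 L v K0 K1 I hI hk)
  -- `f(1) = f(d w̃) = μ f(w̃)`
  have hμ0 : (((χ ((cmBorelTriple L 3 v).proj d) : ℂˣ) : ℂ) * ((rootDeltaChar (cmBorelTriple L 3 v).P d : ℂˣ) : ℂ)) ≠ 0 := mul_ne_zero (Units.ne_zero _) (Units.ne_zero _)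
  have hval : f.toFun 1 = (((χ ((cmBorelTriple L 3 v).proj d) : ℂˣ) : ℂ) * ((rootDeltaChar (cmBorelTriple L 3 v).P d : ℂˣ) : ℂ)) * f.toFun (eA.symm (weylLongU (galAdicCompletionMap (L := L) (IsCMField.complexConj L) hw) (rfl : (StdForm.antidiagonal 3).over (w.1.adicCompletion L) = _))) := by
    have e : (cmPrincipalSeries L 3 v χ ((d : ↥(unitaryGroupOfForm (conjLocal L (IsCMField.complexConj L) v) (cmLocalForm L 3 v))) * (![(1 : ↥(unitaryGroupOfForm (conjLocal L (IsCMField.complexConj L) v) (cmLocalForm L 3 v))), eA.symm (weylLongU (galAdicCompletionMap (L := L) (IsCMField.complexConj L) hw) (rfl : (StdForm.antidiagonal 3).over (w.1.adicCompletion L) = _))] 1)) f).toFun 1 = f.toFun (1 * ((d : ↥(unitaryGroupOfForm (conjLocal L (IsCMField.complexConj L) v) (cmLocalForm L 3 v))) * (![(1 : ↥(unitaryGroupOfForm (conjLocal L (IsCMField.complexConj L) v) (cmLocalForm L 3 v))), eA.symm (weylLongU (galAdicCompletionMap (L := L) (IsCMField.complexConj L) hw) (rfl : (StdForm.antidiagonal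 3).over (w.1.adicCompletion L) = _))] 1))) :=
      Representation.toFun_smoothIndRep_apply ((d : ↥(unitaryGroupOfForm (conjLocal L (IsCMField.complexConj L) v) (cmLocalForm L 3 v))) * (![(1 : ↥(unitaryGroupOfForm (conjLocal L (IsCMField.complexConj L) v) (cmLocalForm L 3 v))), eA.symm (weylLongU (galAdicCompletionMap (L := L) (IsCMField.complexConj L) hw) (rfl : (StdForm.antidiagonal 3).over (w.1.adicCompletion L) = _))] 1)) f 1
    rw [(Representation.mem_fixedPoints _ _ _).1 hf _ hdK1, one_mul, Representation.SmoothInd.toFun_subgroup_mul f d,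
      F0P2nFrobeniusFunctional.twist_comp_proj_character_apply (cmBorelTriple L 3 v) χ d] at e
    simpa using e
  have h := eq_of_mem_fixedPoints_I L v w hw eA heA hϖ g₁ hg₁ K0 K1 I hK0 hK1 hI χ f₁ f_w f hf₁ hf_w hfI h11 h1w hw1 hww
  have hw' : f.toFun (eA.symm (weylLongU (galAdicCompletionMap (L := L) (IsCMField.complexConj L) hw) (rfl : (StdForm.antidiagonal 3).over (w.1.adicCompletion L) = _))) = (((χ ((cmBorelTriple L 3 v).proj d) : ℂˣ) : ℂ) * ((rootDeltaChar (cmBorelTriple L 3 v).P d : ℂˣ) : ℂ))⁻¹ * f.toFun 1 := by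
    rw [hval, ← mul_assoc, inv_mul_cancel₀ hμ0, one_mul]
  rw [hw', mul_comm, ← smul_smul, ← smul_add] at h
  exact h

include heA in
set_option maxHeartbeats 12000000 in
set_option synthInstance.maxHeartbeats 400000 in
-- instance-path unification between `Gqs L v` and the literal carrier of ★ `cmPrincipalSeries` (class of ★ PS-LEVELS)
/-- **`f₁ + μ⁻¹ f_w` IS `K₁`-fixed** (so `i_G(χ)^{K₁} = ℂ(f₁ + μ⁻¹ f_w)`), for unramified `χ` and any Borel `d` with `d·w̃ ∈ K₁`: ★ `dim i_G(χ)^{K₁} = 1` and the previous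
theorem. [cite: Casselman1980, §3] [cite: BruhatTits1972, (4.4.3)] [cite: Tits1979, §3.3.2] -/
theorem add_smul_mem_fixedPoints_K1 {ϖ : w.1.adicCompletion L}
    (hϖ : Valued.v ϖ = WithZero.exp (-1 : ℤ))
    (g₁ : GL (Fin 3) (w.1.adicCompletion L)) (hg₁ : (g₁ : Matrix (Fin 3) (Fin 3) (w.1.adicCompletion L)) = Matrix.diagonal ![(1 : w.1.adicCompletion L), 1, ϖ])
    (K0 K1 I : Subgroup (Gqs L v))
    (hK0 : K0 = ((glInt 3 (w.1.adicCompletion L)).subgroupOf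
      (unitaryGroupOfForm (galAdicCompletionMap (L := L) (IsCMField.complexConj L) hw) ((StdForm.antidiagonal 3).over (w.1.adicCompletion L)))).comap
        eA.toMulEquiv.toMonoidHom)
    (hK1 : K1 = (((glInt 3 (w.1.adicCompletion L)).map (MulAut.conj g₁).toMonoidHom).subgroupOf
      (unitaryGroupOfForm (galAdicCompletionMap (L := L) (IsCMField.complexConj L) hw) ((StdForm.antidiagonal 3).over (w.1.adicCompletion L)))).comap
        eA.toMulEquiv.toMonoidHom)
    (hI : I = K0 ⊓ K1)
    (χ : ↥(torusU (conjLocal L (IsCMField.complexConj L) v) (cmLocalForm L 3 v)) →* ℂˣ)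
    (hU : ∀ t : ↥(torusU (conjLocal L (IsCMField.complexConj L) v) (cmLocalForm L 3 v)),
      (t : ↥(unitaryGroupOfForm (conjLocal L (IsCMField.complexConj L) v) (cmLocalForm L 3 v))) ∈ cmLocalIntegralLevel L 3 (qsForm L) v → χ t = 1)
    (d : ↥(cmBorelTriple L 3 v).P) (hdK1 : (d : ↥(unitaryGroupOfForm (conjLocal L (IsCMField.complexConj L) v) (cmLocalForm L 3 v))) * (![(1 : ↥(unitaryGroupOfForm (conjLocal L (IsCMField.complexConj L) v) (cmLocalForm L 3 v))), eA.symm (weylLongU (galAdicCompletionMap (L := L) (IsCMField.complexConj L) hw) (rfl : (StdForm.antidiagonal 3).over (w.1.adicCompletion L) = _))] 1) ∈ K1) :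
    haveI := locallyCompactSpace_cmBorelU L 3 v
    ∀ (f₁ f_w : Representation.SmoothInd (cmBorelTriple L 3 v).P
        (Representation.twist (((Representation.trivial ℂ ↥(torusU (conjLocal L (IsCMField.complexConj L) v) (cmLocalForm L 3 v)) ℂ).twist χ).comp
          (cmBorelTriple L 3 v).proj) (rootDeltaChar (cmBorelTriple L 3 v).P))),
      f₁ ∈ (cmPrincipalSeries L 3 v χ).fixedPoints I → f_w ∈ (cmPrincipalSeries L 3 v χ).fixedPoints I →
      f₁.toFun 1 = 1 →
      f₁.toFun (eA.symm (weylLongU (galAdicCompletionMap (L := L) (IsCMField.complexConj L) hw) (rfl : (StdForm.antidiagonal 3).over (w.1.adicCompletion L) = _))) = 0 →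
      f_w.toFun 1 = 0 →
      f_w.toFun (eA.symm (weylLongU (galAdicCompletionMap (L := L) (IsCMField.complexConj L) hw) (rfl : (StdForm.antidiagonal 3).over (w.1.adicCompletion L) = _))) = 1 →
      f₁ + (((χ ((cmBorelTriple L 3 v).proj d) : ℂˣ) : ℂ) * ((rootDeltaChar (cmBorelTriple L 3 v).P d : ℂˣ) : ℂ))⁻¹ • f_w ∈ (cmPrincipalSeries L 3 v χ).fixedPoints K1 := by
  intro f₁ f_w hf₁ hf_w h11 h1w hw1 hww
  have hdim := K2E3PSLevelsPF.finrank_fixedPoints_cmPrincipalSeries_K1 L v w hw eA heA hϖ g₁ hg₁ K0 K1 I hK0 hK1 hI χ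
  rw [if_pos hU] at hdim
  obtain ⟨x, hx, -⟩ := finrank_eq_one_iff'.1 hdim
  have hx1 := eq_smul_of_mem_fixedPoints_K1 L v w hw eA heA hϖ g₁ hg₁ K0 K1 I hK0 hK1 hI χ d hdK1 f₁ f_w x.1 hf₁ hf_w x.2 h11 h1w hw1 hww
  obtain ⟨c, hcdef⟩ : ∃ c : ℂ, c = x.1.toFun 1 := ⟨_, rfl⟩
  rw [← hcdef] at hx1
  have hc : c ≠ 0 := by
    intro h0
    apply hx
    simp only [h0, zero_smul] at hx1
    exact Submodule.coe_eq_zero.1 hx1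
  have heq := congrArg (fun y => c⁻¹ • y) hx1
  simp only [smul_smul, inv_mul_cancel₀ hc, one_smul] at heq
  rw [← heq]
  exact Submodule.smul_mem _ _ x.2

include heA in
/-- **There is a Borel `d` with `d·w̃ ∈ K₁`** (`d = eA⁻¹ diag(ϖ⁻¹, 1, σϖ)`, ★ `exists_mem_torusU_mul_weylLongU_mem_conj_glInt` in the model, pulled back along `eA`).
[cite: BruhatTits1972, (4.4.3)] [cite: Tits1979, §2.4, §3.3.2] -/
theorem exists_borel_mul_weyl_mem_K1 {ϖ : w.1.adicCompletion L}
    (hϖ : Valued.v ϖ = WithZero.exp (-1 : ℤ))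
    (g₁ : GL (Fin 3) (w.1.adicCompletion L)) (hg₁ : (g₁ : Matrix (Fin 3) (Fin 3) (w.1.adicCompletion L)) = Matrix.diagonal ![(1 : w.1.adicCompletion L), 1, ϖ])
    (K1 : Subgroup (Gqs L v))
    (hK1 : K1 = (((glInt 3 (w.1.adicCompletion L)).map (MulAut.conj g₁).toMonoidHom).subgroupOf
      (unitaryGroupOfForm (galAdicCompletionMap (L := L) (IsCMField.complexConj L) hw) ((StdForm.antidiagonal 3).over (w.1.adicCompletion L)))).comap
        eA.toMulEquiv.toMonoidHom) :
    ∃ d : ↥(cmBorelTriple L 3 v).P, (d : ↥(unitaryGroupOfForm (conjLocal L (IsCMField.complexConj L) v) (cmLocalForm L 3 v))) * (![(1 : ↥(unitaryGroupOfForm (conjLocal L (IsCMField.complexConj L) v) (cmLocalForm L 3 v))), eA.symm (weylLongU (galAdicCompletionMap (L := L) (IsCMField.complexConj L) hw) (rfl : (StdForm.antidiagonal 3).over (w.1.adicCompletion L) = _))] 1) ∈ K1 := by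
  obtain ⟨d, hdT, hdw⟩ := exists_mem_torusU_mul_weylLongU_mem_conj_glInt (galAdicCompletionMap (L := L) (IsCMField.complexConj L) hw)
    (rfl : (StdForm.antidiagonal 3).over (w.1.adicCompletion L) = _) (galAdicCompletionMap_galAdicCompletionMap_of_smul_eq (IsCMField.complexConj L) w (IsCMField.complexConj_ne_one L) hw) (fun a => valued_galAdicCompletionMap (L := L) (IsCMField.complexConj L) hw a) hϖ g₁ hg₁
  refine ⟨⟨eA.symm d, eA_symm_mem_borel L v w hw eA heA (torusU_le_borelU _ _ hdT)⟩, ?_⟩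
  subst hK1
  let eU : ↥(unitaryGroupOfForm (conjLocal L (IsCMField.complexConj L) v) (cmLocalForm L 3 v)) ≃ₜ* ↥(unitaryGroupOfForm (galAdicCompletionMap (L := L) (IsCMField.complexConj L) hw) ((StdForm.antidiagonal 3).over (w.1.adicCompletion L))) := eA
  have hmem : eU (eU.symm d * (![(1 : ↥(unitaryGroupOfForm (conjLocal L (IsCMField.complexConj L) v) (cmLocalForm L 3 v))), eA.symm (weylLongU (galAdicCompletionMap (L := L) (IsCMField.complexConj L) hw) (rfl : (StdForm.antidiagonal 3).over (w.1.adicCompletion L) = _))] 1)) ∈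
      ((glInt 3 (w.1.adicCompletion L)).map (MulAut.conj g₁).toMonoidHom).subgroupOf
        (unitaryGroupOfForm (galAdicCompletionMap (L := L) (IsCMField.complexConj L) hw) ((StdForm.antidiagonal 3).over (w.1.adicCompletion L))) := by
    rw [map_mul, ContinuousMulEquiv.apply_symm_apply, eA_vec L v w hw eA 1]
    exact hdw
  exact (mem_comap_iff L v w hw eA _ _).2 hmem

end Summit.HodgeConjecture.HodgeConjecture.Cruxes.H413.K2E3PSIwahoriBasisPF

end
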